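import Summits.BirchSwinnertonDyer.BirchSwinnertonDyer.Theorems.BiquadraticEisensteinDescentHeegnerTwistCouplingInSupplySqrtTwoCornerFifteen
import Summits.BirchSwinnertonDyer.BirchSwinnertonDyer.Theorems.BiquadraticEisensteinDescentHeegnerTwistCouplingInSupplySqrtTwoDual
import HarnessLib

set_option linter.dupNamespace false -- `Summit.BirchSwinnertonDyer.BirchSwinnertonDyer.Theorems.…` (summit = sub)
set_option autoImplicit false

/-!
# Crux `HeegnerTwistCouplingInSupply` (stmt-BirchSwinnertonDyer-21381) — card `sqrt2-isogeny-heegner-pin`, the DUAL member at `p ≡ 15 (mod 16)`: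
# CELL-15′ for `B_{2m} : y² = x³ + 8m x² + 8m² x` (`m = pm′`, `(m′/p) = −1`) — UNCONDITIONAL — and the corner for the other root-number `−1`
# member `W = B_{−2p} : y² = x³ − 8p x² + 8p² x` at EVERY prime `p ≡ 15 (mod 16)`, modulo Burungale–Tian + Deuring–Hecke

Route `BiquadraticEisensteinDescent` (cell `pub/bsd-wall`, width seat `bsd-wall-cm-bed-w2` g12; `--supports` 21381, helper). bed-w1 g10's
`…SqrtTwoDual` / `…SqrtTwoDualCorner` did the dual member at `p ≡ 5 (mod 8)` (CELL-5′); this is the `p ≡ 15 (mod 16)` twin. `B_{2m}` is the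
`2`-isogenous partner `⟨0, 8m, 0, 8m², 0⟩` of `B_{−m}`: its `φ̂`-set `S(8m, 8m²)` IS the `φ`-set of `B_{−m}` (`…SqrtTwoCellFifteen.mem_twoIsogenySelmerGroup_phi`,
imported), and its `φ`-set `S(−16m, 32m²)` is decided by bed-w1's `(2/r)` law (`(α, β, c) = (−16, 32, 8)`), the real place (negative classes),
and at `p` by the `2 ± √2` law with square parameters `4m′`, `2m′` (§1).

* §1 `not_isSoluble_padic_dual_at_p` — `φ`-classes `p, 2p` of `B_{2m}` die at `p` (`x⁴ − 4x² + 2` soluble mod `p`, `(m′/p) = −1`);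
* §2 `mem_twoIsogenySelmerGroup_dual_phi` (**`S(−16m, 32m²) ⊆ {1, 2}`**), ★ `rank_eq_zero_and_sha_two_dual` (**`rank B_{2m}(ℚ) = 0`, `Ш[2] = 0`**),
  ★ `selmerCorank_two_dual_eq_zero`, `L_one_ne_zero_dual_of_selmerCorank` (cell-agnostic `corank₂ = 0 ⇒ L(B_{2m}, 1) ≠ 0`, BT + DH);
* §3 `L_twist_ne_zero_of_cell_dual`, ★★ `cruxOnBdualCornerFifteen_of_two_facts` — for EVERY prime `p ≡ 15 (mod 16)` and `W = B_{−2p}`: an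
  imaginary quadratic `K′` (`ℚ(√−5ℓ)` by the dual pin when `p ≡ ±1 (5)`, `ℚ(√−5q)` by the indefinite-pin partner when `p ≡ ±2 (5)`) with
  `4 < |d_{K′}|`, Heegner for `N(B_{−2p})` (prime support `{2,p}`, bed-w1's `eq_two_or_eq_of_prime_dvd_conductorNorm_Bdual`), `L(B_{−2p}^{(d_{K′})}, 1) ≠ 0`,
  `h(K′) < p`, `p ∤ h(K′)` — modulo `hBT` + `hH` only.

HONEST FRAMING: typed sub-corner theorems on ONE CM family; C⁺ untouched; crux 21381 NOT closed; BSD is not proved by any of this.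
THEOREMS ONLY; supports stmt-BirchSwinnertonDyer-21381.
-/

noncomputable section

open scoped Classical

namespace Summit.BirchSwinnertonDyer.BirchSwinnertonDyer.Theorems.BiquadraticEisensteinDescentHeegnerTwistCouplingInSupplySqrtTwoDualFifteen

open _root_.WeierstrassCurve Literature.NumberTheory.EllipticCurves
open Summit.BirchSwinnertonDyer.BirchSwinnertonDyer.Theorems.GoldfeldGoodTwists (mordellWeilRank_congr forall_mem_sha_two_congr)
open Summit.BirchSwinnertonDyer.BirchSwinnertonDyer.Theorems.BiquadraticEisensteinDescentHeegnerTwistCouplingInSupplySqrtTwoCell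
  (not_isSoluble_padic_of_prime_factor not_dvd_two_pow_of_odd_prime natAbs_eq_one_or_two_of_squarefree)
open Summit.BirchSwinnertonDyer.BirchSwinnertonDyer.Theorems.BiquadraticEisensteinDescentHeegnerTwistCouplingInSupplySqrtTwoCellFifteenLocal
  (not_isSoluble_padic_of_dvd_of_rootless rootless_both_of_rootless isSquare_of_root_of_twoPlusSqrtTwo isSquare_of_isSquare_two_mul)
open Summit.BirchSwinnertonDyer.BirchSwinnertonDyer.Theorems.BiquadraticEisensteinDescentHeegnerTwistCouplingInSupplySqrtTwoCellFifteen
  (pos_squarefree_odd dvd_of_dvd_mul_prime eq_of_squarefree_of_prime_factors mem_twoIsogenySelmerGroup_phi not_isSquare_of_jacobiSym_eq_neg_one)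
open Summit.BirchSwinnertonDyer.BirchSwinnertonDyer.Theorems.BiquadraticEisensteinDescentHeegnerTwistCouplingInSupplySqrtTwoLaw
  (twoPlusSqrtTwoIsSquare)
open Summit.BirchSwinnertonDyer.BirchSwinnertonDyer.Theorems.BiquadraticEisensteinDescentHeegnerTwistCouplingInSupplySqrtTwoCorner (j_B)
open Summit.BirchSwinnertonDyer.BirchSwinnertonDyer.Theorems.BiquadraticEisensteinDescentHeegnerTwistCouplingInSupplySqrtTwoDual
  (dvd_of_prime_dvd_of_dvd_thirtytwo_mul_sq twoIsogenySelmerGroup'_dual hab_dual lit_dual isElliptic_dual dual_eq_B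
    eq_two_or_eq_of_prime_dvd_conductorNorm_Bdual)
open Summit.BirchSwinnertonDyer.BirchSwinnertonDyer.Theorems.BiquadraticEisensteinDescentHeegnerTwistCouplingInSupplyThreeSquaresPinDual
  (exists_dualPin_heegnerData)
open Summit.BirchSwinnertonDyer.BirchSwinnertonDyer.Theorems.BiquadraticEisensteinDescentHeegnerTwistCouplingInSupplyThreeSquaresPinCornerDual
  (exists_witnessField_five squarefree_five_mul)
open Summit.BirchSwinnertonDyer.BirchSwinnertonDyer.Theorems.BiquadraticEisensteinDescentHeegnerTwistCouplingInSupplyIndefinitePinWitness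
  (exists_threePlus_classNumber_lt exists_witnessField_five_of jacobiSym_neg_five_mul_cellA ne_of_jacobiSym_ne_zero)

/-! ## §1 At the inert prime `p`, the `φ`-set `S(−16m, 32m²)` of `B_{2m}`: classes `p, 2p` -/

section Local

variable {p : ℕ} [Fact p.Prime]

/-- **`φ`-classes `d = p, 2p` of `B_{2m}` at `p`** (`x⁴ − 4x² + 2` soluble mod `p`, `m = pm′`, `(m′/p) = −1`): the spaces
`w² = p u⁴ − 16m u²z² + 32pm′² z⁴` and `w² = 2p u⁴ − 16m u²z² + 16pm′² z⁴` have no `ℚ_p`-point — reduced quartics `t⁴ − 16m′t² + 32m′²`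
(`c = 4m′`) and `2(t⁴ − 8m′t² + 8m′²)` (`c = 2m′`); a root would make `4m′` resp. `2m′`, hence `m′`, a square.
[cite: SilvermanAEC2009, Prop. X.4.9 (local conditions on C_d)] -/
theorem not_isSoluble_padic_dual_at_p (hp2 : p ≠ 2) {x : ZMod p} (hx : x ^ 4 - 4 * x ^ 2 + 2 = 0)
    {m m' : ℤ} (hm : m = p * m') (hm' : ¬ IsSquare (m' : ZMod p)) :
    ¬ ((twoIsogenyQuartic (-16 * m) p (32 * p * m' ^ 2)).map (Int.castRingHom ℚ_[p])).IsSoluble ∧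
      ¬ ((twoIsogenyQuartic (-16 * m) (2 * p) (16 * p * m' ^ 2)).map (Int.castRingHom ℚ_[p])).IsSoluble := by
  have h2 := BinaryQuartic.two_ne_zero_zmod (p := p) hp2
  obtain ⟨s, hs⟩ : ∃ s : ZMod p, s = x ^ 2 - 2 := ⟨_, rfl⟩
  have hs2 : s ^ 2 = 2 := by rw [hs]; linear_combination hx
  have hs0 : s ≠ 0 := by intro h0; apply h2; rw [← hs2, h0]; ring
  have four_sq : ∀ {c : ZMod p}, IsSquare (4 * c) → IsSquare c := fun ⟨y, hy⟩ =>
    ⟨y / 2, by rw [div_mul_div_comm, eq_div_iff (mul_ne_zero h2 h2)]; linear_combination hy⟩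
  constructor
  · refine not_isSoluble_padic_of_dvd_of_rootless (A₁ := -16 * m') (d₁ := 1) (e₁ := 32 * m' ^ 2)
      (by rw [hm]; ring) (by ring) (by ring) (rootless_both_of_rootless (by norm_num) fun t ht => hm' ?_)
    push_cast at ht
    exact four_sq (isSquare_of_root_of_twoPlusSqrtTwo h2 hx (c := 4 * m') (t := t) (by linear_combination ht))
  · refine not_isSoluble_padic_of_dvd_of_rootless (A₁ := -16 * m') (d₁ := 2) (e₁ := 16 * m' ^ 2)
      (by rw [hm]; ring) (by ring) (by ring) (rootless_both_of_rootless (by exact_mod_cast h2) fun t ht => hm' ?_)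
    push_cast at ht
    refine isSquare_of_isSquare_two_mul hs2 hs0 ?_
    have h2inv : (2 : ZMod p)⁻¹ * 2 = 1 := inv_mul_cancel₀ h2
    exact isSquare_of_root_of_twoPlusSqrtTwo h2 hx (c := 2 * m') (t := t)
      (by linear_combination (2 : ZMod p)⁻¹ * ht - (t ^ 4 - 4 * (2 * (m' : ZMod p)) * t ^ 2 + 2 * (2 * (m' : ZMod p)) ^ 2) * h2inv)

end Local

/-! ## §2 CELL-15′: `S(−16m, 32m²) ⊆ {1, 2}`, rank, `Ш[2]`, corank for `B_{2m}`, `m = pm′` -/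

section Cell

variable {p : ℕ} {m m' : ℤ}

/-- **CELL-15′, `φ`-set of `B_{2m}`: `S(−16m, 32m²) ⊆ {1, 2}`** for `m = pm′`, `p ≡ 15 (16)` prime, `m′ > 0` square-free, `p ∤ m′`, every prime
factor of `m′` `≡ ±3 (8)`, `(m′/p) = −1`: an odd prime `r ≠ p` dividing `d` gives reduced discriminant `2·(8m/r)²` (bed-w1's `(2/r)` law with
`(α, β, c) = (−16, 32, 8)`); `p, 2p` die at `p` (§1); negative classes die over `ℝ` (all coefficients `< 0`). [cite: SilvermanAEC2009, Prop. X.4.9] -/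
theorem mem_twoIsogenySelmerGroup_dual_phi (hp : p.Prime) (hp16 : p % 16 = 15) (hm : m = p * m') (hm'0 : 0 < m')
    (hm' : Squarefree m') (hpm' : ¬ (p : ℤ) ∣ m') (hm'8 : ∀ r : ℕ, r.Prime → (r : ℤ) ∣ m' → r % 8 = 3 ∨ r % 8 = 5)
    (hJ : ¬ IsSquare (m' : ZMod p)) {d : ℤ} (h : d ∈ twoIsogenySelmerGroup (-16 * m) (32 * m ^ 2)) : d = 1 ∨ d = 2 := by
  haveI : Fact p.Prime := ⟨hp⟩
  have hp2 : p ≠ 2 := by rintro rfl; omega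
  obtain ⟨hm0, hmsq, -⟩ := pos_squarefree_odd hp hp2 hm hm'0 hm' hpm' hm'8
  have hp0 : (p : ℤ) ≠ 0 := by exact_mod_cast hp.ne_zero
  have hb : (32 * m ^ 2 : ℤ) ≠ 0 := by positivity
  obtain ⟨hsq, hdvd, hloc⟩ := (mem_twoIsogenySelmerGroup_iff hb).mp h
  -- negative classes: no real point
  have hneg : ∀ {d : ℤ}, d < 0 → d ∣ 32 * m ^ 2 → (twoIsogenyQuartic (-16 * m) d (32 * m ^ 2 / d)).IsLocallySoluble → False :=
    fun {d} hd0 hdvd hloc => by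
      have hmul : d * (32 * m ^ 2 / d) = 32 * m ^ 2 := Int.mul_ediv_cancel' hdvd
      have hd'0 : 32 * m ^ 2 / d < 0 := by
        by_contra hq
        push Not at hq
        nlinarith [mul_nonneg (neg_pos.mpr hd0).le hq, mul_pos hm0 hm0]
      exact not_isSoluble_real_twoIsogenyQuartic_of_neg hd0 hd'0 (by omega) hloc.1
  by_cases hodd : ∃ r : ℕ, r.Prime ∧ r ≠ 2 ∧ r ≠ p ∧ (r : ℤ) ∣ d
  · obtain ⟨r, hr, hr2, hrp, hrd⟩ := hodd
    exfalso
    haveI : Fact r.Prime := ⟨hr⟩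
    have hrm : (r : ℤ) ∣ m := dvd_of_prime_dvd_of_dvd_thirtytwo_mul_sq hr hr2 hrd hdvd
    exact not_isSoluble_padic_of_prime_factor (hm'8 r hr (dvd_of_dvd_mul_prime hr hp hrp hm hrm)) (α := -16) (β := 32)
      (c := 8) (by norm_num) (by simpa using not_dvd_two_pow_of_odd_prime hr hr2 (k := 3)) hmsq hrm hsq hrd hdvd (hloc.2 r)
  · push Not at hodd
    by_cases hpd : (p : ℤ) ∣ d
    · obtain ⟨x, hx⟩ := twoPlusSqrtTwoIsSquare p hp hp16
      obtain ⟨h1, h2⟩ := not_isSoluble_padic_dual_at_p hp2 hx hm hJ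
      rcases eq_of_squarefree_of_prime_factors hp hsq hpd (fun q hqP hqd => by
        by_contra hq; push Not at hq; exact hodd q hqP hq.1 hq.2 hqd) with rfl | rfl | rfl | rfl
      · exfalso
        refine h1 ?_
        have := hloc.2 p
        rwa [show (32 * m ^ 2 : ℤ) / p = 32 * p * m' ^ 2 by
          rw [show (32 * m ^ 2 : ℤ) = p * (32 * p * m' ^ 2) by rw [hm]; ring]
          exact Int.mul_ediv_cancel_left _ hp0] at this
      · exfalso
        refine h2 ?_
        have := hloc.2 p
        rwa [show (32 * m ^ 2 : ℤ) / (2 * p) = 16 * p * m' ^ 2 by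
          rw [show (32 * m ^ 2 : ℤ) = (2 * p) * (16 * p * m' ^ 2) by rw [hm]; ring]
          exact Int.mul_ediv_cancel_left _ (mul_ne_zero two_ne_zero hp0)] at this
      · exact (hneg (by simp [hp.pos]) hdvd hloc).elim
      · exact (hneg (by simp [hp.pos]) hdvd hloc).elim
    · have habs := natAbs_eq_one_or_two_of_squarefree hsq fun q hq hqd => by
        by_contra hq2
        by_cases hqp : q = p
        · exact hpd (by rw [← hqp]; exact hqd)
        · exact hodd q hq hq2 hqp hqd
      rcases Int.natAbs_eq d with hpos | hneg'
      · rcases habs with h1 | h2 <;> omega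
      · exact (hneg (by rcases habs with h1 | h2 <;> omega) hdvd hloc).elim

/-- Arithmetic core: `2^{r+2}·(n₁ n₂) ≤ 4` with the product positive forces `r = 0`, `n₁ = n₂ = 1`. [folklore] -/
private theorem rank_zero_arith {r n₁ n₂ : ℕ} (h4 : 2 ^ (r + 2) * (n₁ * n₂) ≤ 4) (hpos : 0 < 2 ^ (r + 2) * (n₁ * n₂)) :
    r = 0 ∧ n₁ = 1 ∧ n₂ = 1 := by
  have hn : 0 < n₁ * n₂ := Nat.pos_of_ne_zero (by rintro h0; rw [h0, mul_zero] at hpos; exact lt_irrefl 0 hpos)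
  have hn₁ : 0 < n₁ := Nat.pos_of_ne_zero (by rintro rfl; simp at hn)
  have hn₂ : 0 < n₂ := Nat.pos_of_ne_zero (by rintro rfl; simp at hn)
  have h2 : 2 ^ (r + 2) ≤ 4 := le_trans (Nat.le_mul_of_pos_right _ hn) h4
  have hr : r = 0 := by
    by_contra hr
    have h8 : 2 ^ 3 ≤ 2 ^ (r + 2) := Nat.pow_le_pow_right (by norm_num) (by omega)
    omega
  subst hr
  norm_num at h4
  refine ⟨rfl, ?_, ?_⟩ <;> nlinarith

/-- ★ **CELL-15′: `rank B_{2m}(ℚ) = 0` and `Ш(B_{2m}/ℚ)[2] = 0`** for `m = pm′` as above — UNCONDITIONAL: `#S(8m,8m²) ≤ 2`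
(`…SqrtTwoCellFifteen.mem_twoIsogenySelmerGroup_phi`) and `#S(−16m,32m²) ≤ 2` in `2^{dim S + dim S′} = 2^{rank+2}·#Ш(V₀)[Ξ]·#Ш(E)[Ξ]`.
[cite: SilvermanAEC2009, Thm. X.4.2(a), Prop. X.4.9] -/
theorem rank_eq_zero_and_sha_two_dual (hp : p.Prime) (hp16 : p % 16 = 15) (hm : m = p * m') (hm'0 : 0 < m')
    (hm' : Squarefree m') (hpm' : ¬ (p : ℤ) ∣ m') (hm'8 : ∀ r : ℕ, r.Prime → (r : ℤ) ∣ m' → r % 8 = 3 ∨ r % 8 = 5)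
    (hJ : ¬ IsSquare (m' : ZMod p)) :
    (⟨0, 8 * (m : ℚ), 0, 8 * (m : ℚ) ^ 2, 0⟩ : WeierstrassCurve ℚ).mordellWeilRank = 0 ∧
      ∀ c ∈ (⟨0, 8 * (m : ℚ), 0, 8 * (m : ℚ) ^ 2, 0⟩ : WeierstrassCurve ℚ).sha, 2 • c = 0 → c = 0 := by
  have hp2 : p ≠ 2 := by rintro rfl; omega
  have hm0 : 0 < m := (pos_squarefree_odd hp hp2 hm hm'0 hm' hpm' hm'8).1
  have hab := hab_dual hm0.ne'
  haveI := isElliptic_halfModel hab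
  haveI := isElliptic_mk_of_ne_zero (F := ℚ) hab
  haveI := isElliptic_dual hm0.ne'
  have key := two_pow_twoIsogenySelmerRank_add_eq hab
  have hS : (twoIsogenySelmerGroup (8 * m) (8 * m ^ 2)).card ≤ 2 :=
    le_trans (Finset.card_le_card fun d hd => by
      have := mem_twoIsogenySelmerGroup_phi hp hp16 hm hm'0 hm' hpm' hm'8 hJ hd
      simp only [Finset.mem_insert, Finset.mem_singleton]
      exact this) (Finset.card_le_two (a := (1 : ℤ)) (b := 2))
  have hS' : (twoIsogenySelmerGroup' (8 * m) (8 * m ^ 2)).card ≤ 2 := by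
    rw [twoIsogenySelmerGroup'_dual]
    exact le_trans (Finset.card_le_card fun d hd => by
      have := mem_twoIsogenySelmerGroup_dual_phi hp hp16 hm hm'0 hm' hpm' hm'8 hJ hd
      simp only [Finset.mem_insert, Finset.mem_singleton]
      exact this) (Finset.card_le_two (a := (1 : ℤ)) (b := 2))
  have h4 : 2 ^ (twoIsogenySelmerRank (8 * m) (8 * m ^ 2) + twoIsogenySelmerRank' (8 * m) (8 * m ^ 2)) ≤ 4 := by
    rw [pow_add, two_pow_twoIsogenySelmerRank_eq_card hab, two_pow_twoIsogenySelmerRank'_eq_card hab]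
    exact Nat.mul_le_mul hS hS'
  rw [key] at h4
  obtain ⟨hr, h₁, h₂⟩ := rank_zero_arith h4 (by rw [← key]; exact pow_pos two_pos _)
  have hsha := forall_mem_sha_two_smul_eq_zero_of_halfModel (AddSubgroup.eq_bot_of_card_eq _ h₁)
    (AddSubgroup.eq_bot_of_card_eq _ h₂)
  refine ⟨?_, forall_mem_sha_two_congr (lit_dual m).symm hsha⟩
  rw [← mordellWeilRank_congr (lit_dual m)]
  exact hr

/-- ★ **CELL-15′, corank form: `corank_{ℤ₂} Sel_{2^∞}(B_{2m}/ℚ) = 0`.** The instance argument is `…SqrtTwoDual.isElliptic_dual`.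
[cite: SilvermanAEC2009, Thm. X.4.2(a) and Prop. X.4.9] [cite: Greenberg1999, §1] -/
theorem selmerCorank_two_dual_eq_zero (hp : p.Prime) (hp16 : p % 16 = 15) (hm : m = p * m') (hm'0 : 0 < m')
    (hm' : Squarefree m') (hpm' : ¬ (p : ℤ) ∣ m') (hm'8 : ∀ r : ℕ, r.Prime → (r : ℤ) ∣ m' → r % 8 = 3 ∨ r % 8 = 5)
    (hJ : ¬ IsSquare (m' : ZMod p)) [hE : (⟨0, 8 * (m : ℚ), 0, 8 * (m : ℚ) ^ 2, 0⟩ : WeierstrassCurve ℚ).IsElliptic] :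
    (⟨0, 8 * (m : ℚ), 0, 8 * (m : ℚ) ^ 2, 0⟩ : WeierstrassCurve ℚ).selmerCorank 2 = 0 := by
  haveI : Fact (Nat.Prime 2) := ⟨Nat.prime_two⟩
  obtain ⟨hr, hsha⟩ := rank_eq_zero_and_sha_two_dual hp hp16 hm hm'0 hm' hpm' hm'8 hJ
  rw [(⟨0, 8 * (m : ℚ), 0, 8 * (m : ℚ) ^ 2, 0⟩ : WeierstrassCurve ℚ).selmerCorank_eq_mordellWeilRank_add_holds 2, hr,
    (⟨0, 8 * (m : ℚ), 0, 8 * (m : ℚ) ^ 2, 0⟩ : WeierstrassCurve ℚ).shaCorank_eq_zero_of_forall 2 hsha]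

/-- **`L(B_{2m}, 1) ≠ 0` from `corank₂ = 0`, for every `m ≠ 0`** (cell-agnostic; Burungale–Tian at `2` for the CM curve `B_{2m}`, `j = 8000`,
and Deuring–Hecke). [cite: BurungaleTian2026, Thm. 1.1] [cite: SilvermanAEC2009, App. C §11, Example 11.3.1] -/
theorem L_one_ne_zero_dual_of_selmerCorank (hBT : burungaleTian_analyticRank_eq_zero_of_selmerCorank_eq_zero_of_hasCM)
    (hH : hasEntireLFunction_of_j_mem_maximalCMJInvariants) (hm0 : m ≠ 0)
    [hE : (⟨0, 8 * (m : ℚ), 0, 8 * (m : ℚ) ^ 2, 0⟩ : WeierstrassCurve ℚ).IsElliptic]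
    (hcor : (⟨0, 8 * (m : ℚ), 0, 8 * (m : ℚ) ^ 2, 0⟩ : WeierstrassCurve ℚ).selmerCorank 2 = 0) :
    (⟨0, 8 * (m : ℚ), 0, 8 * (m : ℚ) ^ 2, 0⟩ : WeierstrassCurve ℚ).entireLFunction 1 ≠ 0 := by
  haveI : Fact (Nat.Prime 2) := ⟨Nat.prime_two⟩
  have hn : (2 * (m : ℚ)) ≠ 0 := mul_ne_zero two_ne_zero (by exact_mod_cast hm0)
  haveI hE' : (⟨0, 4 * (2 * (m : ℚ)), 0, 2 * (2 * (m : ℚ)) ^ 2, 0⟩ : WeierstrassCurve ℚ).IsElliptic := by rwa [← dual_eq_B]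
  have hj : (⟨0, 8 * (m : ℚ), 0, 8 * (m : ℚ) ^ 2, 0⟩ : WeierstrassCurve ℚ).j = 8000 := by
    have h := j_B hn
    simp only [← dual_eq_B] at h
    convert h
  have h0 := hBT _ (hasCM_of_j_eq_8000 _ hj) 2 hcor
  refine (analyticRank_eq_zero_iff_holds (W := (⟨0, 8 * (m : ℚ), 0, 8 * (m : ℚ) ^ 2, 0⟩ : WeierstrassCurve ℚ)) (hH _ ?_)).1 h0
  rw [hj]
  simp [maximalCMJInvariants]

end Cell

/-! ## §3 The corner for `W = B_{−2p}` at every prime `p ≡ 15 (mod 16)` -/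

section Corner

/-- **The `L`-half on CELL-15′**: `p ≡ 15 (16)` prime, `m′ > 0` square-free, `p ∤ m′`, prime factors of `m′` `≡ ±3 (8)`, `(−m′/p) = +1`
⇒ `L(B_{−2p}^{(−m′)}, 1) = L(B_{2pm′}, 1) ≠ 0`, modulo Burungale–Tian + Deuring–Hecke. [cite: BurungaleTian2026, Thm. 1.1] [cite: SilvermanAEC2009, Prop. X.4.9] -/
theorem L_twist_ne_zero_of_cell_dual (hBT : burungaleTian_analyticRank_eq_zero_of_selmerCorank_eq_zero_of_hasCM)
    (hH : hasEntireLFunction_of_j_mem_maximalCMJInvariants) {p : ℕ} (hp : p.Prime) (hp16 : p % 16 = 15) {m' : ℕ}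
    (hm'0 : 0 < m') (hm'sq : Squarefree m') (hpm' : ¬ p ∣ m') (hm'8 : ∀ r : ℕ, r.Prime → r ∣ m' → r % 8 = 3 ∨ r % 8 = 5)
    (hJ : jacobiSym (-(m' : ℤ)) p = 1) :
    ((⟨0, -8 * (p : ℚ), 0, 8 * (p : ℚ) ^ 2, 0⟩ : WeierstrassCurve ℚ).quadraticTwist ((-(m' : ℤ) : ℤ) : ℚ)).entireLFunction 1 ≠ 0 := by
  haveI : Fact p.Prime := ⟨hp⟩
  set m : ℤ := (p : ℤ) * (m' : ℤ) with hm
  have hm0 : 0 < m := by have := hp.pos; positivity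
  have htw : (⟨0, -8 * (p : ℚ), 0, 8 * (p : ℚ) ^ 2, 0⟩ : WeierstrassCurve ℚ).quadraticTwist ((-(m' : ℤ) : ℤ) : ℚ) =
      ⟨0, 8 * (m : ℚ), 0, 8 * (m : ℚ) ^ 2, 0⟩ := by
    rw [quadraticTwist_mk, hm]; push_cast; ext <;> simp <;> ring
  rw [htw]
  haveI := isElliptic_dual hm0.ne'
  have hJ' : jacobiSym (m' : ℤ) p = -1 := by
    have hm1 : jacobiSym (-1) p = -1 := by
      rw [jacobiSym.at_neg_one (Nat.odd_iff.mpr (by omega)), ZMod.χ₄_nat_eq_if_mod_four, if_neg (by omega), if_neg (by omega)]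
    have : jacobiSym (-(m' : ℤ)) p = jacobiSym (-1) p * jacobiSym (m' : ℤ) p := by
      rw [← jacobiSym.mul_left]; ring_nf
    rw [this, hm1] at hJ
    linarith [hJ]
  exact L_one_ne_zero_dual_of_selmerCorank hBT hH hm0.ne' (selmerCorank_two_dual_eq_zero hp hp16 hm (by exact_mod_cast hm'0)
    (Int.squarefree_natCast.mpr hm'sq) (fun h => hpm' (by exact_mod_cast h)) (fun r hr hrd => hm'8 r hr (by exact_mod_cast hrd))
    (not_isSquare_of_jacobiSym_eq_neg_one hJ'))

/-- ★★ **The dual corner at EVERY prime `p ≡ 15 (mod 16)`**: for `W = B_{−2p} : y² = x³ − 8p x² + 8p² x` (`j = 8000`, the other root-number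
`−1` member) there is an imaginary quadratic `K′` with `4 < |d_{K′}|`, Heegner for `N(B_{−2p})` (prime support `{2, p}`),
`L(B_{−2p}^{(d_{K′})}, 1) ≠ 0`, `h(K′) < p`, `p ∤ h(K′)` — modulo Burungale–Tian + Deuring–Hecke only. Cells as for `B_p`: `p ≡ ±1 (mod 5)` by the
dual pin (`K′ = ℚ(√−5ℓ)`, `m′ = 5ℓ`), `p ≡ ±2 (mod 5)` by the indefinite-pin partner (`K′ = ℚ(√−5q)`, `m′ = 5q`). The binders `IsGloballyMinimal`,
`NeZero N` mirror the crux and are unused. HONEST FRAMING: a sub-corner of one CM family; crux 21381 is NOT closed; BSD is not proved by this.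
[cite: BurungaleTian2026, Thm. 1.1] [cite: SilvermanAEC2009, Prop. X.4.9] [cite: Oesterle1988Gauss, II §3 Proposition p. 57 (27)] -/
theorem cruxOnBdualCornerFifteen_of_two_facts (hBT : burungaleTian_analyticRank_eq_zero_of_selmerCorank_eq_zero_of_hasCM)
    (hH : hasEntireLFunction_of_j_mem_maximalCMJInvariants) :
    ∀ (p : ℕ) [Fact p.Prime] [(⟨0, -8 * (p : ℚ), 0, 8 * (p : ℚ) ^ 2, 0⟩ : WeierstrassCurve ℚ).IsElliptic]
      [(⟨0, -8 * (p : ℚ), 0, 8 * (p : ℚ) ^ 2, 0⟩ : WeierstrassCurve ℚ).IsGloballyMinimal]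
      [NeZero ((⟨0, -8 * (p : ℚ), 0, 8 * (p : ℚ) ^ 2, 0⟩ : WeierstrassCurve ℚ).conductorNorm ℤ)],
      p % 16 = 15 →
      ∃ (K : Type) (_ : Field K) (_ : NumberField K),
        IsImaginaryQuadratic K ∧ 4 < (NumberField.discr K).natAbs ∧
        SatisfiesHeegnerHypothesis ((⟨0, -8 * (p : ℚ), 0, 8 * (p : ℚ) ^ 2, 0⟩ : WeierstrassCurve ℚ).conductorNorm ℤ) K ∧
        ((⟨0, -8 * (p : ℚ), 0, 8 * (p : ℚ) ^ 2, 0⟩ : WeierstrassCurve ℚ).quadraticTwist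
          (NumberField.discr K : ℚ)).entireLFunction 1 ≠ 0 ∧
        NumberField.classNumber K < p ∧ ¬ p ∣ NumberField.classNumber K := by
  intro p hpF _ _ _ hp16
  have hp : p.Prime := hpF.out
  have hN := fun r hr hrN => eq_two_or_eq_of_prime_dvd_conductorNorm_Bdual
    (p := p) (r := r) hp hr hrN
  by_cases hB : p % 5 = 1 ∨ p % 5 = 4
  · -- T_B′: dual pin `ℓ ≡ 3 (8)`, `(ℓ/p) = −1`, `K′ = ℚ(√−5ℓ)`, `m′ = 5ℓ`
    obtain ⟨ℓ, hℓ, hℓlt, hℓ8, -, -, hJ5, hsz⟩ := exists_dualPin_heegnerData hp (by omega) hB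
    obtain ⟨K, iF, iN, hK, hdK, hHg, hcl⟩ := exists_witnessField_five hp (by omega) hℓ hℓ8 hJ5 hsz hN
    have hℓ5 : ℓ ≠ 5 := by rintro rfl; omega
    have hL := L_twist_ne_zero_of_cell_dual hBT hH hp hp16 (m' := 5 * ℓ) (by omega) (squarefree_five_mul hℓ hℓ5)
      (fun h => by
        rcases (Nat.Prime.dvd_mul hp).mp h with h5 | hl
        · have := (Nat.prime_dvd_prime_iff_eq hp Nat.prime_five).mp h5; omega
        · have := (Nat.prime_dvd_prime_iff_eq hp hℓ).mp hl; omega)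
      (fun r hr hrd => by
        rcases (Nat.Prime.dvd_mul hr).mp hrd with h5 | hl
        · have := (Nat.prime_dvd_prime_iff_eq hr Nat.prime_five).mp h5; omega
        · have := (Nat.prime_dvd_prime_iff_eq hr hℓ).mp hl; omega)
      (by push_cast; exact hJ5)
    refine ⟨K, iF, iN, hK, ?_, hHg, ?_, hcl, fun hdvd =>
      absurd (Nat.le_of_dvd (NumberField.classNumber_pos K) hdvd) (not_le.mpr hcl)⟩
    · rw [hdK, Int.natAbs_neg, Int.natAbs_natCast]; have := hℓ.two_le; omega
    · rw [hdK]; exact hL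
  · -- cell A′: indefinite-pin partner `q ≡ 3 (8)`, `(q/p) = +1`, `K′ = ℚ(√−5q)`, `m′ = 5q`
    have hp5 : p % 5 = 2 ∨ p % 5 = 3 := by
      have : p % 5 ≠ 0 := fun h => by
        have := (Nat.prime_dvd_prime_iff_eq Nat.prime_five hp).mp (Nat.dvd_of_mod_eq_zero h); omega
      omega
    obtain ⟨q, hq, hq8, hJ, hh⟩ := exists_threePlus_classNumber_lt hp (by omega) hp5 (by omega)
    have hJ5 := jacobiSym_neg_five_mul_cellA (by omega) hp5 hJ
    obtain ⟨K, iF, iN, hK, hdK, hHg, hcl⟩ := exists_witnessField_five_of hq hq8 hJ5 hh hN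
    have hq5 : q ≠ 5 := by rintro rfl; omega
    have hqp : q ≠ p := ne_of_jacobiSym_ne_zero hp (by rw [hJ]; norm_num)
    have hL := L_twist_ne_zero_of_cell_dual hBT hH hp hp16 (m' := 5 * q) (by have := hq.pos; omega) (squarefree_five_mul hq hq5)
      (fun h => by
        rcases (Nat.Prime.dvd_mul hp).mp h with h5 | hl
        · have := (Nat.prime_dvd_prime_iff_eq hp Nat.prime_five).mp h5; omega
        · exact hqp ((Nat.prime_dvd_prime_iff_eq hp hq).mp hl).symm)
      (fun r hr hrd => by
        rcases (Nat.Prime.dvd_mul hr).mp hrd with h5 | hl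
        · have := (Nat.prime_dvd_prime_iff_eq hr Nat.prime_five).mp h5; omega
        · have := (Nat.prime_dvd_prime_iff_eq hr hq).mp hl; omega)
      (by push_cast; exact hJ5)
    refine ⟨K, iF, iN, hK, ?_, hHg, ?_, hcl, fun hdvd =>
      absurd (Nat.le_of_dvd (NumberField.classNumber_pos K) hdvd) (not_le.mpr hcl)⟩
    · rw [hdK, Int.natAbs_neg, Int.natAbs_natCast]; have := hq.two_le; omega
    · rw [hdK]; exact hL

end Corner

end Summit.BirchSwinnertonDyer.BirchSwinnertonDyer.Theorems.BiquadraticEisensteinDescentHeegnerTwistCouplingInSupplySqrtTwoDualFifteen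

end
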